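import Mathlib.RingTheory.SimpleModule.Isotypic
import Literature.NumberTheory.Automorphic.Liu2021.AppendixC.OmegaHomBlockSelector
import Literature.NumberTheory.Automorphic.Liu2021.AppendixC.OmegaHomIsotypic
import Literature.NumberTheory.Automorphic.Liu2021.AppendixC.EtaleH1LevelSemisimple
import HarnessLib

/-!
# [Liu 2021, p. 133 (D.3)] the isotypic component of `[·]_K⁻¹ f′(ω^K)` in `ℚ̄_ℓ ⊗ H¹_ét(A_K)` consists of block values
# (the Hecke-module half of the d6 S2′ binder `hIsoSpan`, in `isotypicComponent` currency)

Topic `NumberTheory/Automorphic/Liu2021/AppendixC`; namespace `Literature.NumberTheory.Automorphic.Liu2021.AppendixC.Sec42Data.HeckeTranslates`.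
THEOREMS ONLY (no definition, no named fact, no instance, no `sorry`).  Print, [Liu2021] p. 133 (D.3): the `(π^∞)^K`-isotypic part `H¹_B(Sh_K, ℂ)[(π^∞)^K]`
of the level-`K` cohomology is swept out by the `G(𝔸^∞)`-intertwiners `π^∞ → H¹(A_∞)` ([Bump1997] Prop. 4.2.3, «`π^K ≠ 0` determines `π`»).

Setting (the variables of ★ `OmegaHomBlockSelector` §2): a tower `C` with Hecke translates `T`, injective pull-backs `hI`, descent up to isogeny `hD`, an étale
Hecke datum `X` with `X.rhoEt = T.etHeckeRep ℓ`, `ι : ℂ ≃ ℚ̄_ℓ`, an IRREDUCIBLE `ℂ[𝔾]`-module `(W, ρW)` and `f′ ∈ X.omegaHom ι ρW`; the `G`-level semisimplicity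
sentence of (D.3) enters as the explicit binder `(σ) (hσ : ∀ g, σ g = (X.rhoEt g) ⊗ 1) [σ.IsSemisimpleRepresentation]` (as in ★ `OmegaHomIsotypic`,
★ `EtaleH1LevelSemisimple`).  Write `M := ℚ̄_ℓ ⊗ H¹_ét(A_K)`, `[·]_K ⊗ 1 : M → ℚ̄_ℓ ⊗ H¹_ét(A_∞)`, `𝒜 ⊆ End(M)` any subalgebra containing the `ᵗV_ℓ^ℚ(heckeEnd K g) ⊗ 1` (e.g. the one they generate) and
`N₀ := [·]_K⁻¹ f′(ω^K)`, an `𝒜`-submodule of `M` (★ `baseChange_dualMap_rationalTateAction_heckeEnd_mem_comap_map`; simple by ★ `eq_bot_or_coe_eq_of_forall_heckeEnd_stable`).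

* **`map_le_span_blockValues_of_linearMap`** — for every `𝒜`-submodule `m` of `M` and every `𝒜`-linear `φ : N₀ → m`, `([·]_K ⊗ 1)(φ(N₀)) ⊆ span(block values)`:
  `φ ∘ ([·]_K ⊗ 1)⁻¹ ∘ f′` is an `ι`-semilinear Hecke-equivariant map `ω^K → (ℚ̄_ℓ ⊗ H¹_ét(A_∞))^K`, hence (★ `OmegaHomIsotypic.map_fixedPoints_le_span_blockValues`,
  i.e. [Bump1997] 4.2.3 in surjective form for the semisimple `σ`) the restriction of an element of `X.omegaHom ι ρW`.
* **`map_isotypicComponent_le_span_blockValues`** — consequently the whole ISOTYPIC COMPONENT `isotypicComponent 𝒜 M N₀` (Mathlib: the sum of the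
  `𝒜`-submodules `≃ N₀`) is carried by `[·]_K ⊗ 1` into `span_{ℚ̄_ℓ} {y | ∃ f ∈ X.omegaHom ι ρW, ∃ w, f w = y}` — the inclusion «π_lab-isotypic part ⊆
  `Σ_f f(ω^K)`» of the binder `hIsoSpan`; with ★ `CentralCharacterIsotypic` ∕ (4b) «σ-eigenspace of the centre on the block = isotypic component» this is (4′).

Count-neutral (`--supports` stmt-HodgeConjecture-24832); HC_CM is proved only modulo the 7 printed citations until rung 0 closes.

## References
* [Liu2021] Y. Liu, *Fourier–Jacobi cycles and arithmetic relative trace formula*, Camb. J. Math. 9 (2021), p. 133 (D.3), p. 140 (FJcycle.tex l. 5626), §4.2.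
* [Bump1997] D. Bump, *Automorphic Forms and Representations* (1997), Prop. 4.2.3 (p. 427).
* [BushnellHenniart2006] C. J. Bushnell, G. Henniart, *The Local Langlands Conjecture for GL(2)* (2006), §4.3 Proposition (2) (pp. 38–39).
-/

set_option autoImplicit false

noncomputable section

open CategoryTheory NumberField Function MulAction
open scoped TensorProduct

namespace Literature.NumberTheory.Automorphic.Liu2021.AppendixC

open Literature.AlgebraicGeometry.Motives (AbelianVariety)
open Literature.AlgebraicGeometry.Motives.AbelianVariety (rationalTateModuleMap endAlgebra rationalTateAction)

variable {F E : Type} [Field F] [NumberField F] [IsTotallyReal F] [Field E] [NumberField E] [Algebra F E]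
  [IsTotallyComplex E] [Algebra.IsQuadraticExtension F E]
variable {P5 : PropC5Data F E} {isotropicAt : ℕ → Prop}

namespace Sec42Data.HeckeTranslates

variable {C : Sec42Data P5 isotropicAt} (T : C.HeckeTranslates) {ℓ : ℕ} [Fact ℓ.Prime]
variable (K : C5.SmallLevel C.S.K₀)
  (hI : ∀ ⦃K K' : C5.SmallLevel C.S.K₀⦄ (f : K' ⟶ K), Function.Injective (rationalTateModuleMap ℓ (C.Atr f)).dualMap)
  (X : C.EtaleHeckeDatum ℓ) (hX : X.rhoEt = T.etHeckeRep ℓ) (ι : ℂ ≃+* AlgebraicClosure ℚ_[ℓ])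
  {W : Type} [AddCommGroup W] [Module ℂ W] (ρW : Representation ℂ C.G W)
  {f : W →ₛₗ[(ι : ℂ →+* AlgebraicClosure ℚ_[ℓ])] AlgebraicClosure ℚ_[ℓ] ⊗[ℚ_[ℓ]] C.etaleH1Tower ℓ} (hf : f ∈ X.omegaHom ι ρW)
  (σ : Representation (AlgebraicClosure ℚ_[ℓ]) C.G (AlgebraicClosure ℚ_[ℓ] ⊗[ℚ_[ℓ]] C.etaleH1Tower ℓ))
  (hσ : ∀ g : C.G, σ g = (X.rhoEt g).baseChange (AlgebraicClosure ℚ_[ℓ]))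

include hI hX hf in
/-- **`([·]_K ⊗ 1)⁻¹ ∘ f′` on `ω^K`**: an `ι`-semilinear `ψ : ω^K → ℚ̄_ℓ ⊗ H¹_ét(A_K)` with `([·]_K ⊗ 1) (ψ w) = f′ w` (the values of `f′` on `ω^K` are level-`K` classes,
★ `apply_mem_range_toTower_baseChange`, and `[·]_K ⊗ 1` is injective). [cite: Liu2021, Thm. 4.18 (1) (FJcycle.tex l. 2239) and §4.2 (l. 2158–2166)] -/
theorem exists_semilinear_level_lift (hD : T.IsogenyDescent) :
    ∃ ψ : ↥(ρW.fixedPoints (K.1.1 : Subgroup C.G)) →ₛₗ[(ι : ℂ →+* AlgebraicClosure ℚ_[ℓ])] AlgebraicClosure ℚ_[ℓ] ⊗[ℚ_[ℓ]] C.etaleH1 ℓ K,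
      ∀ w, (C.toTower ℓ K).baseChange (AlgebraicClosure ℚ_[ℓ]) (ψ w) = f (w : W) := by
  have hjinj : Function.Injective ((C.toTower ℓ K).baseChange (AlgebraicClosure ℚ_[ℓ])) :=
    toTower_baseChange_injective C ℓ (C.toTower_injective ℓ hI K)
  have hfrange : ∀ w : ↥(ρW.fixedPoints (K.1.1 : Subgroup C.G)),
      f (w : W) ∈ LinearMap.range ((C.toTower ℓ K).baseChange (AlgebraicClosure ℚ_[ℓ])) :=
    fun w => T.apply_mem_range_toTower_baseChange K hI X hX ι ρW hf hD w.2
  refine ⟨(LinearEquiv.ofInjective _ hjinj).symm.toLinearMap.comp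
    ((f.domRestrict (ρW.fixedPoints (K.1.1 : Subgroup C.G))).codRestrict (LinearMap.range ((C.toTower ℓ K).baseChange (AlgebraicClosure ℚ_[ℓ])))
      fun w => hfrange w), fun w => ?_⟩
  rw [LinearMap.comp_apply, LinearEquiv.coe_toLinearMap, LinearEquiv.ofInjective_symm_apply]
  rfl

include hX hf hσ in
/-- **The level lift is Hecke-equivariant**: `ψ ([KgK]_ω w) = (ᵗV_ℓ^ℚ(heckeEnd K g) ⊗ 1) (ψ w)` for `ψ` as in `exists_semilinear_level_lift` (`f′` intertwines `[KgK]_ω`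
with `1 ⊗ [KgK]`, ★ `OmegaHomHeckeOperator`; `[·]_K ⊗ 1` intertwines `ᵗV_ℓ^ℚ(heckeEnd K g) ⊗ 1` with `[KgK]`, ★ `toTower_baseChange_dualMap_rationalTateAction_heckeEnd`).
[cite: Liu2021, §4.2 (FJcycle.tex l. 2154–2166)] [cite: Bump1997, Prop. 4.2.3] -/
theorem semilinear_level_lift_heckeOperator (hD : T.IsogenyDescent) [σ.IsSemisimpleRepresentation]
    (hinj : Function.Injective ((C.toTower ℓ K).baseChange (AlgebraicClosure ℚ_[ℓ])))
    (ψ : ↥(ρW.fixedPoints (K.1.1 : Subgroup C.G)) →ₛₗ[(ι : ℂ →+* AlgebraicClosure ℚ_[ℓ])] AlgebraicClosure ℚ_[ℓ] ⊗[ℚ_[ℓ]] C.etaleH1 ℓ K)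
    (hψ : ∀ w, (C.toTower ℓ K).baseChange (AlgebraicClosure ℚ_[ℓ]) (ψ w) = f (w : W)) (g : C.G)
    (w : ↥(ρW.fixedPoints (K.1.1 : Subgroup C.G))) :
    ψ ⟨heckeOperator ρW (K.1.1 : Subgroup C.G) g (w : W),
        Literature.NumberTheory.Automorphic.heckeOperator_apply_mem_fixedPoints ρW _ g w.2 (finite_orbit_smallLevel' K g)⟩ =
      ((rationalTateAction (C.A K) ℓ (T.heckeEnd hD K g)).dualMap).baseChange (AlgebraicClosure ℚ_[ℓ]) (ψ w) := by
  have hσ' : ∀ g : C.G, σ g = (T.etHeckeRep ℓ g).baseChange (AlgebraicClosure ℚ_[ℓ]) := fun g => by rw [hσ, hX]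
  apply hinj
  rw [hψ, T.toTower_baseChange_ops_eq_heckeOperator ℓ K σ hσ' hD g, hψ]
  change f (heckeOperator ρW (K.1.1 : Subgroup C.G) g (w : W)) = _
  rw [Sec42Data.EtaleHeckeDatum.apply_heckeOperator_eq_baseChange_heckeOperator_apply X ι ρW hf _ g (finite_orbit_smallLevel' K g) w.2,
    Sec42Data.EtaleHeckeDatum.heckeOperator_eq_baseChange_of_eq X σ hσ _ g (finite_orbit_smallLevel' K g)]

set_option maxHeartbeats 800000 in
include hI hX hf hσ in
/-- **Every `𝒜`-linear image of `N₀ = [·]_K⁻¹ f′(ω^K)` consists of block values.**  For a subalgebra `𝒜 ⊆ End(ℚ̄_ℓ ⊗ H¹_ét(A_K))` CONTAINING the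
realised Hecke endomorphisms `ᵗV_ℓ^ℚ(heckeEnd K g) ⊗ 1` (e.g. the algebra they generate), an `𝒜`-submodule `N₀` with underlying subspace `[·]_K⁻¹ f′(ω^K)`,
an `𝒜`-submodule `m` and an `𝒜`-linear `φ : N₀ → m`, the class `([·]_K ⊗ 1)(φ x)` is a value of an element of `X.omegaHom ι ρW` for every `x ∈ N₀`:
`φ ∘ ([·]_K ⊗ 1)⁻¹ ∘ f′` on `ω^K` is `ι`-semilinear and Hecke-equivariant, so it is the restriction of an element of the Hom-space (★ `OmegaHomIsotypic`,
[Bump1997] 4.2.3 in surjective form for the semisimple `σ`). [cite: Liu2021, p. 133 (D.3)] [cite: Bump1997, Prop. 4.2.3]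
[cite: BushnellHenniart2006, §4.3 Proposition (2) (pp. 38–39)] -/
theorem map_le_span_blockValues_of_linearMap (hD : T.IsogenyDescent) [ρW.IsIrreducible] [σ.IsSemisimpleRepresentation]
    (𝒜 : Subalgebra (AlgebraicClosure ℚ_[ℓ]) (Module.End (AlgebraicClosure ℚ_[ℓ]) (AlgebraicClosure ℚ_[ℓ] ⊗[ℚ_[ℓ]] C.etaleH1 ℓ K)))
    (h𝒜 : ∀ g : C.G, ((rationalTateAction (C.A K) ℓ (T.heckeEnd hD K g)).dualMap).baseChange (AlgebraicClosure ℚ_[ℓ]) ∈ 𝒜)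
    (N₀ : Submodule ↥𝒜 (AlgebraicClosure ℚ_[ℓ] ⊗[ℚ_[ℓ]] C.etaleH1 ℓ K))
    (hN₀ : N₀.restrictScalars (AlgebraicClosure ℚ_[ℓ]) =
      ((ρW.fixedPoints (K.1.1 : Subgroup C.G)).map f).comap ((C.toTower ℓ K).baseChange (AlgebraicClosure ℚ_[ℓ])))
    (m : Submodule ↥𝒜 (AlgebraicClosure ℚ_[ℓ] ⊗[ℚ_[ℓ]] C.etaleH1 ℓ K)) (φ : ↥N₀ →ₗ[↥𝒜] ↥m) (x : ↥N₀) :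
    (C.toTower ℓ K).baseChange (AlgebraicClosure ℚ_[ℓ]) ((φ x : ↥m) : AlgebraicClosure ℚ_[ℓ] ⊗[ℚ_[ℓ]] C.etaleH1 ℓ K) ∈
      Submodule.span (AlgebraicClosure ℚ_[ℓ]) {y | ∃ f ∈ X.omegaHom ι ρW, ∃ w : W, f w = y} := by
  classical
  have hσ' : ∀ g : C.G, σ g = (T.etHeckeRep ℓ g).baseChange (AlgebraicClosure ℚ_[ℓ]) := fun g => by rw [hσ, hX]
  have hjinj : Function.Injective ((C.toTower ℓ K).baseChange (AlgebraicClosure ℚ_[ℓ])) :=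
    toTower_baseChange_injective C ℓ (C.toTower_injective ℓ hI K)
  have hjK : LinearMap.range ((C.toTower ℓ K).baseChange (AlgebraicClosure ℚ_[ℓ])) = σ.fixedPoints (K.1.1 : Subgroup C.G) :=
    T.range_toTower_baseChange_eq_fixedPoints ℓ K hI σ hσ' hD
  have hfin : ∀ g : C.G, (orbit (K.1.1 : Subgroup C.G) (g : C.G ⧸ (K.1.1 : Subgroup C.G))).Finite := fun g => finite_orbit_smallLevel' K g
  -- `([·]_K ⊗ 1) ∘ ops_g = (1 ⊗ [KgK]) ∘ ([·]_K ⊗ 1)`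
  have hjops : ∀ (g : C.G) (z : AlgebraicClosure ℚ_[ℓ] ⊗[ℚ_[ℓ]] C.etaleH1 ℓ K),
      (C.toTower ℓ K).baseChange (AlgebraicClosure ℚ_[ℓ])
          ((((rationalTateAction (C.A K) ℓ (T.heckeEnd hD K g)).dualMap).baseChange (AlgebraicClosure ℚ_[ℓ])) z) =
        (heckeOperator X.rhoEt (K.1.1 : Subgroup C.G) g).baseChange (AlgebraicClosure ℚ_[ℓ]) ((C.toTower ℓ K).baseChange (AlgebraicClosure ℚ_[ℓ]) z) := by
    intro g z
    rw [T.toTower_baseChange_ops_eq_heckeOperator ℓ K σ hσ' hD g,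
      Sec42Data.EtaleHeckeDatum.heckeOperator_eq_baseChange_of_eq X σ hσ _ g (hfin g)]
  -- `φ` commutes with `ops_g` (it is `𝒜`-linear and `ops_g ∈ 𝒜`)
  have hφops : ∀ (g : C.G) (y : ↥N₀) (z : AlgebraicClosure ℚ_[ℓ] ⊗[ℚ_[ℓ]] C.etaleH1 ℓ K)
      (hz : z = (((rationalTateAction (C.A K) ℓ (T.heckeEnd hD K g)).dualMap).baseChange (AlgebraicClosure ℚ_[ℓ])) (y : AlgebraicClosure ℚ_[ℓ] ⊗[ℚ_[ℓ]] C.etaleH1 ℓ K))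
      (hzN : z ∈ N₀),
      ((φ ⟨z, hzN⟩ : ↥m) : AlgebraicClosure ℚ_[ℓ] ⊗[ℚ_[ℓ]] C.etaleH1 ℓ K) =
        (((rationalTateAction (C.A K) ℓ (T.heckeEnd hD K g)).dualMap).baseChange (AlgebraicClosure ℚ_[ℓ])) ((φ y : ↥m) : AlgebraicClosure ℚ_[ℓ] ⊗[ℚ_[ℓ]] C.etaleH1 ℓ K) := by
    intro g y z hz hzN
    subst hz
    exact congrArg (fun z : ↥m => (z : AlgebraicClosure ℚ_[ℓ] ⊗[ℚ_[ℓ]] C.etaleH1 ℓ K)) (φ.map_smul ⟨_, h𝒜 g⟩ y)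
  -- the level lift `ψ = ([·]_K ⊗ 1)⁻¹ ∘ f′`, valued in `N₀`, Hecke-equivariant
  obtain ⟨ψ, hψ⟩ := T.exists_semilinear_level_lift K hI X hX ι ρW hf hD
  have hψN : ∀ w, ψ w ∈ N₀.restrictScalars (AlgebraicClosure ℚ_[ℓ]) := by
    intro w
    rw [hN₀, Submodule.mem_comap, hψ]
    exact ⟨w, w.2, rfl⟩
  have hψT := T.semilinear_level_lift_heckeOperator K X hX ι ρW hf σ hσ hD hjinj ψ hψ
  have hψmem : ∀ (g : C.G) (w : ↥(ρW.fixedPoints (K.1.1 : Subgroup C.G))),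
      (((rationalTateAction (C.A K) ℓ (T.heckeEnd hD K g)).dualMap).baseChange (AlgebraicClosure ℚ_[ℓ])) (ψ w) ∈ N₀ := by
    intro g w
    rw [← hψT g w]
    exact hψN _
  -- `Ψ : ω^K → N₀`, the same map with values in the `𝒜`-module `N₀` (packaged existentially to keep terms small)
  obtain ⟨Ψ, hΨ⟩ : ∃ Ψ : ↥(ρW.fixedPoints (K.1.1 : Subgroup C.G)) →ₛₗ[(ι : ℂ →+* AlgebraicClosure ℚ_[ℓ])] ↥N₀,
      ∀ w, ((Ψ w : ↥N₀) : AlgebraicClosure ℚ_[ℓ] ⊗[ℚ_[ℓ]] C.etaleH1 ℓ K) = ψ w := by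
    let ψ₀ : ↥(ρW.fixedPoints (K.1.1 : Subgroup C.G)) →ₛₗ[(ι : ℂ →+* AlgebraicClosure ℚ_[ℓ])] ↥(N₀.restrictScalars (AlgebraicClosure ℚ_[ℓ])) :=
      ψ.codRestrict _ hψN
    let toN₀ : ↥(N₀.restrictScalars (AlgebraicClosure ℚ_[ℓ])) →ₗ[AlgebraicClosure ℚ_[ℓ]] ↥N₀ :=
      { toFun := fun y => ⟨(y : AlgebraicClosure ℚ_[ℓ] ⊗[ℚ_[ℓ]] C.etaleH1 ℓ K), y.2⟩
        map_add' := fun _ _ => rfl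
        map_smul' := fun _ _ => rfl }
    exact ⟨toN₀.comp ψ₀, fun _ => rfl⟩
  have hΨT : ∀ (g : C.G) (w : ↥(ρW.fixedPoints (K.1.1 : Subgroup C.G))),
      Ψ ⟨heckeOperator ρW (K.1.1 : Subgroup C.G) g (w : W),
        Literature.NumberTheory.Automorphic.heckeOperator_apply_mem_fixedPoints ρW _ g w.2 (finite_orbit_smallLevel' K g)⟩ =
        ⟨_, hψmem g w⟩ := by
    intro g w
    apply Subtype.ext
    rw [hΨ, hψT g w]
  -- THE map `L = ([·]_K ⊗ 1) ∘ incl ∘ φ ∘ Ψ ∘ proj` (packaged existentially)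
  obtain ⟨L, hLapply⟩ : ∃ L : W →ₛₗ[(ι : ℂ →+* AlgebraicClosure ℚ_[ℓ])] AlgebraicClosure ℚ_[ℓ] ⊗[ℚ_[ℓ]] C.etaleH1Tower ℓ,
      ∀ (w : W) (hw : w ∈ ρW.fixedPoints (K.1.1 : Subgroup C.G)),
        L w = (C.toTower ℓ K).baseChange (AlgebraicClosure ℚ_[ℓ]) ((φ (Ψ ⟨w, hw⟩) : ↥m) : AlgebraicClosure ℚ_[ℓ] ⊗[ℚ_[ℓ]] C.etaleH1 ℓ K) := by
    obtain ⟨Q, hQ⟩ := (ρW.fixedPoints (K.1.1 : Subgroup C.G)).exists_isCompl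
    let proj : W →ₗ[ℂ] ↥(ρW.fixedPoints (K.1.1 : Subgroup C.G)) := (ρW.fixedPoints (K.1.1 : Subgroup C.G)).projectionOnto Q hQ
    let φ' : ↥N₀ →ₗ[AlgebraicClosure ℚ_[ℓ]] ↥m := φ.restrictScalars (AlgebraicClosure ℚ_[ℓ])
    let incl : ↥m →ₗ[AlgebraicClosure ℚ_[ℓ]] AlgebraicClosure ℚ_[ℓ] ⊗[ℚ_[ℓ]] C.etaleH1 ℓ K := m.subtype.restrictScalars (AlgebraicClosure ℚ_[ℓ])
    refine ⟨((C.toTower ℓ K).baseChange (AlgebraicClosure ℚ_[ℓ])).comp (incl.comp (φ'.comp (Ψ.comp proj))), fun w hw => ?_⟩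
    change (C.toTower ℓ K).baseChange (AlgebraicClosure ℚ_[ℓ]) ((φ (Ψ (proj w)) : ↥m) : AlgebraicClosure ℚ_[ℓ] ⊗[ℚ_[ℓ]] C.etaleH1 ℓ K) = _
    rw [Submodule.projectionOnto_apply_of_mem_left hQ hw]
  -- hypotheses of the extension theorem
  have hLK : ∀ w ∈ ρW.fixedPoints (K.1.1 : Subgroup C.G), ∀ k ∈ (K.1.1 : Subgroup C.G), (X.rhoEt k).baseChange (AlgebraicClosure ℚ_[ℓ]) (L w) = L w := by
    intro w hw k hk
    have hmem : L w ∈ σ.fixedPoints (K.1.1 : Subgroup C.G) := by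
      rw [← hjK, hLapply w hw]
      exact ⟨_, rfl⟩
    rw [Representation.mem_fixedPoints] at hmem
    rw [← hσ]
    exact hmem k hk
  have hL : ∀ (g : C.G), ∀ w ∈ ρW.fixedPoints (K.1.1 : Subgroup C.G),
      L (heckeOperator ρW K.1.1 g w) = (heckeOperator X.rhoEt K.1.1 g).baseChange (AlgebraicClosure ℚ_[ℓ]) (L w) := by
    intro g w hw
    rw [hLapply _ (Literature.NumberTheory.Automorphic.heckeOperator_apply_mem_fixedPoints ρW _ g hw (hfin g)),
      hΨT g ⟨w, hw⟩, hφops g (Ψ ⟨w, hw⟩) _ (by rw [hΨ]) (hψmem g ⟨w, hw⟩), hjops, hLapply w hw]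
  -- conclude: `([·]_K ⊗ 1) (φ x) = L w` for `w` with `f′ w = ([·]_K ⊗ 1) x`
  have hx : (x : AlgebraicClosure ℚ_[ℓ] ⊗[ℚ_[ℓ]] C.etaleH1 ℓ K) ∈ N₀.restrictScalars (AlgebraicClosure ℚ_[ℓ]) := x.2
  rw [hN₀, Submodule.mem_comap] at hx
  obtain ⟨w, hw, hwx⟩ := hx
  have hΨw : Ψ ⟨w, hw⟩ = x := by
    apply Subtype.ext
    rw [hΨ]
    apply hjinj
    rw [hψ]
    exact hwx
  have hmain := Sec42Data.EtaleHeckeDatum.map_fixedPoints_le_span_blockValues X ι ρW σ hσ K L hLK hL ⟨w, hw, rfl⟩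
  rw [hLapply w hw, hΨw] at hmain
  exact hmain

include hI hX hf hσ in
/-- **THE ISOTYPIC COMPONENT OF `N₀ = [·]_K⁻¹ f′(ω^K)` CONSISTS OF BLOCK VALUES** ([Liu2021] (D.3): «`H¹(A_K)[(π^∞)^K]`» is swept out by the intertwiners
`π^∞ → H¹(A_∞)`): for every subalgebra `𝒜 ⊆ End(ℚ̄_ℓ ⊗ H¹_ét(A_K))` containing the realised Hecke endomorphisms and every `𝒜`-submodule `N₀` with underlying
subspace `[·]_K⁻¹ f′(ω^K)`, `([·]_K ⊗ 1)(isotypicComponent 𝒜 M S) ⊆ span_{ℚ̄_ℓ} {f w : f ∈ X.omegaHom ι ρW}` for every `𝒜`-module `S ≃ N₀` (the type `S` is abstract so that the consumer՚s own instance path on `↥N₀` is used; `ρW` irreducible, `σ = 1 ⊗ rhoEt` semisimple) —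
the «π_lab-isotypic part ⊆ `Σ_f f(ω^K)`» inclusion of the S2′ binder `hIsoSpan`. [cite: Liu2021, p. 133 (D.3)] [cite: Bump1997, Prop. 4.2.3]
[cite: BushnellHenniart2006, §4.3 Proposition (2) (pp. 38–39)] -/
theorem map_isotypicComponent_le_span_blockValues (hD : T.IsogenyDescent) [ρW.IsIrreducible] [σ.IsSemisimpleRepresentation]
    (𝒜 : Subalgebra (AlgebraicClosure ℚ_[ℓ]) (Module.End (AlgebraicClosure ℚ_[ℓ]) (AlgebraicClosure ℚ_[ℓ] ⊗[ℚ_[ℓ]] C.etaleH1 ℓ K)))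
    (h𝒜 : ∀ g : C.G, ((rationalTateAction (C.A K) ℓ (T.heckeEnd hD K g)).dualMap).baseChange (AlgebraicClosure ℚ_[ℓ]) ∈ 𝒜)
    (N₀ : Submodule ↥𝒜 (AlgebraicClosure ℚ_[ℓ] ⊗[ℚ_[ℓ]] C.etaleH1 ℓ K))
    (hN₀ : N₀.restrictScalars (AlgebraicClosure ℚ_[ℓ]) =
      ((ρW.fixedPoints (K.1.1 : Subgroup C.G)).map f).comap ((C.toTower ℓ K).baseChange (AlgebraicClosure ℚ_[ℓ])))
    (S : Type*) [AddCommGroup S] [Module ↥𝒜 S] (eS : S ≃ₗ[↥𝒜] ↥N₀) :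
    ((isotypicComponent ↥𝒜 (AlgebraicClosure ℚ_[ℓ] ⊗[ℚ_[ℓ]] C.etaleH1 ℓ K) S).restrictScalars (AlgebraicClosure ℚ_[ℓ])).map
        ((C.toTower ℓ K).baseChange (AlgebraicClosure ℚ_[ℓ])) ≤
      Submodule.span (AlgebraicClosure ℚ_[ℓ]) {y | ∃ f ∈ X.omegaHom ι ρW, ∃ w : W, f w = y} := by
  rw [Submodule.map_le_iff_le_comap, isotypicComponent, Submodule.restrictScalars_sSup]
  refine sSup_le ?_
  rintro _ ⟨m, ⟨e⟩, rfl⟩ y hy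
  rw [Submodule.mem_comap]
  -- `e' := eS ∘ e : m ≃ N₀`
  have : (((e.trans eS).symm ((e.trans eS) ⟨y, hy⟩) : ↥m) : AlgebraicClosure ℚ_[ℓ] ⊗[ℚ_[ℓ]] C.etaleH1 ℓ K) = y := by
    rw [LinearEquiv.symm_apply_apply]
  rw [← this]
  exact T.map_le_span_blockValues_of_linearMap K hI X hX ι ρW hf σ hσ hD 𝒜 h𝒜 N₀ hN₀ m (e.trans eS).symm.toLinearMap ((e.trans eS) ⟨y, hy⟩)

end Sec42Data.HeckeTranslates

end Literature.NumberTheory.Automorphic.Liu2021.AppendixC
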